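import Literature.AlgebraicGeometry.HodgeTheory.AbelianVarietyEndomorphismStableSubvarieties
import Literature.AlgebraicGeometry.Motives.AbelianVarietyQuasiIdempotentImageOrder
import HarnessLib

/-!
# Every endomorphism is an isogeny up to an integer translate, `N + ψ`; an abelian subvariety is stable under all
# endomorphisms iff it is stable under all self-isogenies (Mumford §19 Thm. 3–4; Zarhin 2008 Thm. 3.2)

Layer `Literature/AlgebraicGeometry/HodgeTheory`; theorems only (no `def`, no instance, no named fact; net debt 0); §§1–2 over an
ARBITRARY field.  `End X` is a finitely generated `ℤ`-module (Mumford §19 Thm. 3, the tree's `module_finite_hom_holds`), so every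
`ψ ∈ End X` is integral over `ℤ`: `p(ψ) = 0` with `p ∈ ℤ[x]` monic.  Dividing `p` by `x + N` gives `p = p(-N) + (x + N) q(x)`,
whence `(N + ψ) q(ψ) = q(ψ) (N + ψ) = -p(-N)`: for every integer `N ≥ 0` with `p(-N) ≠ 0` — all but finitely many — `N • 𝟙 + ψ` is
an ISOGENY (`f ≫ h = h ≫ f = c • 𝟙`, `c ≠ 0`).  Consequently an abelian subvariety `Z ↪ X` with `φ(Z) ⊆ Z` for every SELF-ISOGENY
`φ : X → X` is already `End X`-stable (`ψ(Z) = ((N + ψ)|_Z - N)(Z) ⊆ Z`), and (§3, perfect field, with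
`…EndomorphismStableSubvarieties`) an abelian variety has finitely many abelian subvarieties iff each of them is carried into
itself by every self-isogeny.

THE PRINT.  Mumford, *Abelian Varieties* §19 Thm. 3 (p. 176: `End X` is a finitely generated free `ℤ`-module) and Thm. 4 with
its proof (pp. 179–182: the characteristic polynomial of an endomorphism; `deg(n + φ)`); Zarhin 2008 Thm. 3.2 and §5 (pp. 7, 9);
Milne 1986 Prop. 12.4 and §12 p. 125 (`α ↦ deg α` is a polynomial function, `P_α(n) = deg(α - n)`).

Results (namespace `Literature.AlgebraicGeometry.HodgeTheory.AbelianVariety`):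
* §1 (any field) `exists_monic_eval₂_end_eq_zero` (integrality of endomorphisms over `ℤ`), **`isIsogeny_nsmul_id_add_of_eval_ne_zero`**
  (`p(ψ) = 0`, `p(-N) ≠ 0` ⟹ `N • 𝟙 + ψ` isogeny), **`finite_setOf_not_isIsogeny_nsmul_id_add`** (`N • 𝟙 + ψ` is an isogeny for
  all but finitely many `N`), **`exists_isIsogeny_nsmul_id_add`**;
* §2 (any field) `range_comp_subset_of_range_comp_nsmul_id_add_subset`,
  **`forall_range_comp_subset_iff_forall_isIsogeny`** (`End X`-stable iff stable under all self-isogenies);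
* §3 (perfect field) **`finite_setOf_range_subvariety_iff_forall_isIsogeny_range_comp_subset`** (finitely many abelian subvarieties
  iff every abelian subvariety is stable under every self-isogeny).

## References
* [MumfordAV1970] D. Mumford, *Abelian Varieties* (1970), §19 Thm. 3 (p. 176), Thm. 4 (pp. 179–182).
* [Zarhin2008HomomorphismsFiniteFields] Yu. G. Zarhin, *Homomorphisms of abelian varieties over finite fields* (2008)
  (arXiv:0711.1615), Thm. 3.2 and §5 (pp. 7, 9).
* [Milne1986AbelianVarieties] J. S. Milne, *Abelian Varieties*, in Cornell–Silverman (1986), Prop. 12.4 and §12 p. 125.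
-/

noncomputable section

universe u

open CategoryTheory CategoryTheory.Limits Polynomial

namespace Literature.AlgebraicGeometry.HodgeTheory

namespace AbelianVariety

open _root_.AlgebraicGeometry
open Literature.AlgebraicGeometry.Motives Literature.AlgebraicGeometry.Motives.AbelianVariety

variable {K : Type u} [Field K]

/-! ## §1 `N • 𝟙 + ψ` is an isogeny for almost all `N` (any field) -/

section Translate

variable {X : Motives.AbelianVariety K} (ψ : X ⟶ X)

/-- **Endomorphisms are integral over `ℤ`**: `p(ψ) = 0` for a monic `p ∈ ℤ[x]` (`End X` is a finitely generated `ℤ`-module).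
[cite: MumfordAV1970, §19 Thm. 3 (p. 176) and Thm. 4 (p. 180)] -/
theorem exists_monic_eval₂_end_eq_zero : ∃ p : ℤ[X], p.Monic ∧ p.eval₂ (Int.castRingHom (End X)) (End.of ψ) = 0 := by
  letI : Algebra ℤ (End X) := Ring.toIntAlgebra _
  haveI : Module.Finite ℤ (End X) := module_finite_hom_holds X X
  obtain ⟨p, hp, hpψ⟩ := (IsIntegral.of_finite ℤ (End.of ψ) : IsIntegral ℤ (End.of ψ))
  exact ⟨p, hp, hpψ⟩

/-- **`p(ψ) = 0` and `p(-N) ≠ 0` force `N • 𝟙 + ψ` to be an isogeny**: `p = p(-N) + (x + N) q` gives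
`(N + ψ) q(ψ) = q(ψ) (N + ψ) = -p(-N) • 𝟙`, a non-zero integer. [cite: MumfordAV1970, §19 Thm. 4 and its proof (pp. 179–182)]
[cite: Milne1986AbelianVarieties, Prop. 12.4 and §12 p. 125] -/
theorem isIsogeny_nsmul_id_add_of_eval_ne_zero {p : ℤ[X]} (hpψ : p.eval₂ (Int.castRingHom (End X)) (End.of ψ) = 0) {N : ℕ}
    (hN : p.eval (-(N : ℤ)) ≠ 0) : IsIsogeny (N • 𝟙 X + ψ) := by
  letI : Algebra ℤ (End X) := Ring.toIntAlgebra _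
  have hpψ' : aeval (End.of ψ) p = 0 := by rw [aeval_def]; exact hpψ
  set q : ℤ[X] := p /ₘ (Polynomial.X - C (-(N : ℤ))) with hq
  have hdiv : C (p.eval (-(N : ℤ))) + (Polynomial.X - C (-(N : ℤ))) * q = p := by
    rw [← modByMonic_X_sub_C_eq_C_eval]
    exact modByMonic_add_div p _
  have hdiv' : C (p.eval (-(N : ℤ))) + q * (Polynomial.X - C (-(N : ℤ))) = p := by rw [mul_comm]; exact hdiv
  have hU : aeval (End.of ψ) (Polynomial.X - C (-(N : ℤ))) = End.of (N • 𝟙 X + ψ) := by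
    rw [map_sub, aeval_X, aeval_C, map_neg, map_natCast, sub_neg_eq_add, add_comm, ← nsmul_one N]
    rfl
  set c : ℤ := -(p.eval (-(N : ℤ))) with hc
  have hc0 : c ≠ 0 := neg_ne_zero.2 hN
  have h1 : End.of (N • 𝟙 X + ψ) * aeval (End.of ψ) q = algebraMap ℤ (End X) c := by
    have h := congrArg (aeval (End.of ψ)) hdiv
    rw [map_add, map_mul, aeval_C, hU, hpψ', add_comm, add_eq_zero_iff_eq_neg, ← map_neg] at h
    exact h
  have h2 : aeval (End.of ψ) q * End.of (N • 𝟙 X + ψ) = algebraMap ℤ (End X) c := by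
    have h := congrArg (aeval (End.of ψ)) hdiv'
    rw [map_add, map_mul, aeval_C, hU, hpψ', add_comm, add_eq_zero_iff_eq_neg, ← map_neg] at h
    exact h
  rw [End.mul_def, Algebra.algebraMap_eq_smul_one] at h1 h2
  exact isIsogeny_of_comp_eq_of_comp_eq (h := End.asHom (aeval (End.of ψ) q)) (isIsogeny_zsmul_id_holds X c hc0)
    (isIsogeny_zsmul_id_holds X c hc0) h1 h2

/-- **`N • 𝟙 + ψ` IS AN ISOGENY FOR ALL BUT FINITELY MANY `N ∈ ℕ`** (the exceptions are among the integer roots of `p(-x)`).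
[cite: MumfordAV1970, §19 Thm. 4 (pp. 179–182)] [cite: Milne1986AbelianVarieties, Prop. 12.4 and §12 p. 125] -/
theorem finite_setOf_not_isIsogeny_nsmul_id_add : {N : ℕ | ¬ IsIsogeny (N • 𝟙 X + ψ)}.Finite := by
  obtain ⟨p, hp, hpψ⟩ := exists_monic_eval₂_end_eq_zero ψ
  refine ((finite_setOf_isRoot hp.ne_zero).preimage (f := fun N : ℕ ↦ -(N : ℤ)) fun a _ b _ h ↦ ?_).subset fun N hN ↦ ?_
  · exact_mod_cast neg_injective h
  · by_contra hroot
    exact hN (isIsogeny_nsmul_id_add_of_eval_ne_zero ψ hpψ hroot)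

/-- **Every endomorphism is an isogeny up to an integer translate**: `N • 𝟙 + ψ` is an isogeny for some `N ∈ ℕ`.
[cite: MumfordAV1970, §19 Thm. 4 (pp. 179–182)] -/
theorem exists_isIsogeny_nsmul_id_add : ∃ N : ℕ, IsIsogeny (N • 𝟙 X + ψ) := by
  obtain ⟨N, hN⟩ := (finite_setOf_not_isIsogeny_nsmul_id_add ψ).exists_notMem
  exact ⟨N, not_not.1 hN⟩

end Translate

/-! ## §2 Stable under self-isogenies iff stable under endomorphisms (any field) -/

section Stable

variable {X Z : Motives.AbelianVariety K} (j : Z ⟶ X) [IsClosedImmersion (Hom.toSchemeHom j)]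

/-- If `(N • 𝟙 + ψ)(Z) ⊆ Z` then `ψ(Z) ⊆ Z`: `j ≫ (N • 𝟙 + ψ) = t ≫ j` gives `j ≫ ψ = (t - N • 𝟙) ≫ j`. [cite: MumfordAV1970, §19 Thm. 1 (p. 173)] -/
theorem range_comp_subset_of_range_comp_nsmul_id_add_subset (ψ : X ⟶ X) (N : ℕ)
    (h : Set.range (Hom.toSchemeHom (j ≫ (N • 𝟙 X + ψ))) ⊆ Set.range (Hom.toSchemeHom j)) :
    Set.range (Hom.toSchemeHom (j ≫ ψ)) ⊆ Set.range (Hom.toSchemeHom j) := by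
  obtain ⟨t, ht, -⟩ := existsUnique_hom_comp_eq_of_range_subset (j ≫ (N • 𝟙 X + ψ)) j h
  have hψ : j ≫ ψ = (t - N • 𝟙 Z) ≫ j := by
    rw [Preadditive.sub_comp, ht, Preadditive.comp_add, Preadditive.comp_nsmul, Category.comp_id, Preadditive.nsmul_comp,
      Category.id_comp, add_sub_cancel_left]
  rw [hψ]
  exact range_toSchemeHom_comp_subset _ _

/-- **AN ABELIAN SUBVARIETY IS `End X`-STABLE IFF IT IS STABLE UNDER EVERY SELF-ISOGENY OF `X`** (any field).
[cite: Zarhin2008HomomorphismsFiniteFields, Thm. 3.2 and §5 (pp. 7, 9)] [cite: MumfordAV1970, §19 Thm. 4 (pp. 179–182)] -/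
theorem forall_range_comp_subset_iff_forall_isIsogeny :
    (∀ φ : X ⟶ X, Set.range (Hom.toSchemeHom (j ≫ φ)) ⊆ Set.range (Hom.toSchemeHom j)) ↔
      ∀ φ : X ⟶ X, IsIsogeny φ → Set.range (Hom.toSchemeHom (j ≫ φ)) ⊆ Set.range (Hom.toSchemeHom j) := by
  refine ⟨fun h φ _ ↦ h φ, fun h ψ ↦ ?_⟩
  obtain ⟨N, hN⟩ := exists_isIsogeny_nsmul_id_add ψ
  exact range_comp_subset_of_range_comp_nsmul_id_add_subset j ψ N (h _ hN)

end Stable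

/-! ## §3 Finitely many abelian subvarieties iff all are stable under self-isogenies (perfect field) -/

section Perfect

variable [PerfectField K] (X : Motives.AbelianVariety K)

/-- **AN ABELIAN VARIETY HAS FINITELY MANY ABELIAN SUBVARIETIES IFF EVERY ABELIAN SUBVARIETY IS CARRIED INTO ITSELF BY EVERY
SELF-ISOGENY** (perfect field; complement to «finite up to the action of `Aut X`»). [cite: Zarhin2008HomomorphismsFiniteFields, Thm. 3.2 and §5 (pp. 7, 9)]
[cite: MumfordAV1970, §19 Cor. 1–2 of Thm. 1 (pp. 173–174) and Thm. 4 (p. 180)] -/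
theorem finite_setOf_range_subvariety_iff_forall_isIsogeny_range_comp_subset :
    {R : Set X.X.left | ∃ (Z : Motives.AbelianVariety K) (j : Z ⟶ X),
        IsClosedImmersion (Hom.toSchemeHom j) ∧ R = Set.range (Hom.toSchemeHom j)}.Finite ↔
      ∀ (Z : Motives.AbelianVariety K) (j : Z ⟶ X), IsClosedImmersion (Hom.toSchemeHom j) →
        ∀ φ : X ⟶ X, IsIsogeny φ → Set.range (Hom.toSchemeHom (j ≫ φ)) ⊆ Set.range (Hom.toSchemeHom j) := by
  rw [finite_setOf_range_subvariety_iff_forall_range_comp_subset X]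
  refine ⟨fun h Z j hj φ _ ↦ h Z j hj φ, fun h Z j hj ↦ ?_⟩
  haveI := hj
  exact (forall_range_comp_subset_iff_forall_isIsogeny j).2 (h Z j hj)

end Perfect

end AbelianVariety

end Literature.AlgebraicGeometry.HodgeTheory

end
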